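import Literature.Computability.MetaComplexity.HeuristicClassesAmplificationProofs
import Literature.Computability.MetaComplexity.HeuristicClassesHeurBPPReductionProofs
import Literature.Computability.Complexity.BPPErrorReduction
import HarnessLib

/-!
# Amplification of parametrised PPT algorithms (crux `ArithStatLadder.AvgFaceBeyondPrior`, stmt-QuantumAdvantage-2427)

Stub `stub_paramAmplification` of the line `cubic-discriminant-pseudorandomness`: for a PPT
randomized algorithm `A` on parametrised inputs `⟨x, 1ⁿ⟩` (`paramEnc`) and every `η > 0` there is
a PPT `A'` on the same inputs whose coin error is `≤ η` on every input on which the coin error of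
`A` is `< 1/4` — the remark "the choice of the constant `1/4` is arbitrary" after Bogdanov–Trevisan's
Def. 2.11 (majority vote over independent runs, Arora–Barak Thm. 7.10).

The argument is the `paramEnc` port of the `schemeEnc` plumbing of
`Literature/Computability/MetaComplexity/HeuristicClassesAmplificationProofs.lean`:

* *machines* — a PPT algorithm on `paramEnc` inputs is packaged as the **total** `FP` function
  `w ↦ [A.run (⟨⟨w⟩₁⟩₁, |⟨⟨w⟩₁⟩₂|) ⟨w⟩₂]` through the normaliser `polyTimeComputable_decParam`
  (`runFn_mem_FP_param`), and read back as `IsPolyTime paramEnc encodeBool`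
  (`isPolyTime_of_runFn_mem_FP_param`, `decParam ∘ paramEnc = id`);
* *one round* of majority of three on the coin blocks `(r₀)₀, (r₀)₁, (r₁)₀` of the twice
  deinterleaved coin string (`everyOther`; the coin budget is an arbitrary function of the input
  length, so independent runs read deinterleaved coins, not consecutive blocks): a brick term
  (`iteFn`), coin error `e ↦ e² (3 − 2e)` by exact counting (`cnt_everyOther`,
  `cnt_everyOther_true`) and monotonicity (`sq_mul_three_sub_mono`) — `exists_maj3Round_gen`,
  verbatim the tree's `exists_maj3Round` for an arbitrary input decoder/encoder pair;
* *all rounds* — `k` rounds bring an error `≤ 1/3` to `≤ errSeq k` (`exists_rounds_gen`,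
  `errSeq (k+1) = (errSeq k)² (3 − 2 errSeq k)`), and `errSeq k ≤ η` eventually (`exists_errSeq_le`).

Theorem-only file; the intermediate algorithms are structure literals inside existence statements.
-/

set_option linter.dupNamespace false

namespace Summit.QuantumAdvantage.QuantumAdvantage.Theorems.AvgFaceBeyondPrior.Cubic

open _root_.Computability Literature.Computability.Complexity Literature.Computability.MetaComplexity
open Literature.Computability.Complexity.Brick

/-! ## §1 Parametrised randomized algorithms as total `FP` functions -/

/-- **The run map of a PPT parametrised algorithm is a total `FP` function.** If
`A : RandAlg (List Bool × ℕ) Bool` is polynomial time on the parameter encoding (machine inputs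
`⟨⟨x, 1ⁿ⟩, r⟩`), then `w ↦ [A.run (⟨⟨w⟩₁⟩₁, |⟨⟨w⟩₁⟩₂|) ⟨w⟩₂] ∈ FP`: precompose the machine of `A`
with the normaliser `w ↦ ⟨paramEnc (⟨⟨w⟩₁⟩₁, |⟨⟨w⟩₁⟩₂|), ⟨w⟩₂⟩` (`polyTimeComputable_decParam`,
`fanoutFn_mem_FP`, `PolyTimeComputable.comp_holds`). [cite: AroraBarak2009, §1.3 (composition)] -/
theorem runFn_mem_FP_param {A : RandAlg (List Bool × ℕ) Bool} (hA : A.IsPolyTime paramEnc encodeBool) :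
    (fun w => [A.run (fstF (fstF w), (sndF (fstF w)).length) (sndF w)]) ∈ FP := by
  have hN : (paramEnc ∘ fun w => (fstF w, (sndF w).length)) ∈ FP :=
    PolyTimeComputable.of_encode_eq (f := fun w => (fstF w, (sndF w).length)) (ea := id)
      (eb := paramEnc) id (fun _ => rfl) (fun _ => rfl) polyTimeComputable_decParam
  have hM : fanoutFn ((paramEnc ∘ fun w => (fstF w, (sndF w).length)) ∘ fstF) sndF ∈ FP :=
    fanoutFn_mem_FP (comp_mem_FP hN fstF_mem_FP) sndF_mem_FP
  have hdec : PolyTimeComputable (id : List Bool → List Bool)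
      (fun p : (List Bool × ℕ) × List Bool => boolPair (paramEnc p.1) p.2)
      (fun w => ((fstF (fstF w), (sndF (fstF w)).length), sndF w)) :=
    PolyTimeComputable.of_encode_eq
      (f := fanoutFn ((paramEnc ∘ fun w => (fstF w, (sndF w).length)) ∘ fstF) sndF)
      (ea := id) (eb := id) id (fun _ => rfl) (fun w => by rw [fanoutFn_apply]; rfl) hM
  exact PolyTimeComputable.of_encode_eq (f := Function.uncurry A.run ∘ fun w =>
      ((fstF (fstF w), (sndF (fstF w)).length), sndF w)) (ea := id) (eb := encodeBool) id
    (fun _ => rfl) (fun _ => rfl) (PolyTimeComputable.comp_holds hA.1 hdec)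

/-- `|1ⁿ| = n` (Mathlib's `unaryDecodeNat` is `List.length`). [folklore] -/
private theorem length_unaryEncodeNat (n : ℕ) : (unaryEncodeNat n).length = n :=
  unary_decode_encode_nat n

/-- **Back to machines.** A Boolean parametrised randomized algorithm whose run map is realised by
the total `FP` function `w ↦ [B.run (⟨⟨w⟩₁⟩₁, |⟨⟨w⟩₁⟩₂|) ⟨w⟩₂]`, with a polynomially bounded coin
budget, is PPT on the parameter encoding (the decoder fixes `paramEnc (x, n)`: same machine).
[cite: AroraBarak2009, §1.3 (composition)] -/
theorem isPolyTime_of_runFn_mem_FP_param {B : RandAlg (List Bool × ℕ) Bool}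
    (hF : (fun w => [B.run (fstF (fstF w), (sndF (fstF w)).length) (sndF w)]) ∈ FP)
    (hp : ∃ p : Polynomial ℕ, ∀ n, B.coinLen n ≤ p.eval n) : B.IsPolyTime paramEnc encodeBool :=
  ⟨PolyTimeComputable.of_encode_eq
      (f := fun w => [B.run (fstF (fstF w), (sndF (fstF w)).length) (sndF w)]) (ea := id) (eb := id)
      (fun p : (List Bool × ℕ) × List Bool => boolPair (paramEnc p.1) p.2) (fun _ => rfl)
      (fun p => by
        obtain ⟨⟨x, n⟩, r⟩ := p
        simp only [paramEnc, fstF_boolPair, sndF_boolPair, length_unaryEncodeNat]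
        rfl) hF,
    hp⟩

/-! ## §2 One round of majority of three on deinterleaved coins -/

/-- The majority of three bits is wrong iff both of the first two are wrong and the third is right,
or one of the first two and the third are wrong. [cite: AroraBarak2009, Thm. 7.10 (proof)] -/
private theorem maj3_ne_iff (a b d c : Bool) :
    maj3 a b d ≠ c ↔ (a ≠ c ∧ b ≠ c) ∧ ¬ d ≠ c ∨ (a ≠ c ∨ b ≠ c) ∧ d ≠ c := by
  revert a b d c
  decide

/-- **One round of majority of three** (generic input type `α`, decoder `d`, encoder `ea`). For a
Boolean randomized algorithm `B` on `α` whose run map through the decoder `d` is a total `FP`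
function `w ↦ [B.run (d ⟨w⟩₁) ⟨w⟩₂]`, with a polynomially bounded coin budget `m(N)`, there is another
such algorithm `B'` — on coins `r ∈ {0,1}^{4 m(N)}` output the majority of `B` run on the coin blocks
`(r₀)₀, (r₀)₁, (r₁)₀` of the twice deinterleaved string (`everyOther`), a brick term (`iteFn`
twice) — such that on every input `q` and target bit `c`: `Pr_coins[B ≠ c] ≤ e ≤ 1` implies
`Pr_coins[B' ≠ c] ≤ e² (3 − 2e)` (probabilities w.r.t. any encoder `ea`, which only fixes the coin
length). Counting: with `b = #bad`, `a = 2^m − b`, the bad coin strings number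
`2^m (b² a + (4^m − a²) b) = 2^m b² (3·2^m − 2b)` (`cnt_everyOther`, `cnt_everyOther_true`), and
`u ↦ u² (3 − 2u)` is monotone (`sq_mul_three_sub_mono`). Verbatim the tree's `exists_maj3Round`
(there `d = decScheme`, `ea = schemeEnc`). [cite: BogdanovTrevisan2006, §2.3 (remark after Def. 2.11)]
[cite: AroraBarak2009, Thm. 7.10] -/
theorem exists_maj3Round_gen {α : Type} (d : List Bool → α) (ea : α → List Bool) {B : RandAlg α Bool}
    (hF : (fun w => [B.run (d (fstF w)) (sndF w)]) ∈ FP)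
    (hp : ∃ p : Polynomial ℕ, ∀ n, B.coinLen n ≤ p.eval n) :
    ∃ B' : RandAlg α Bool,
      (fun w => [B'.run (d (fstF w)) (sndF w)]) ∈ FP ∧
      (∃ p : Polynomial ℕ, ∀ n, B'.coinLen n ≤ p.eval n) ∧
      ∀ (q : α) (c : Bool) (e : ℝ), B.pr ea q {b | b ≠ c} ≤ e → e ≤ 1 →
        B'.pr ea q {b | b ≠ c} ≤ e ^ 2 * (3 - 2 * e) := by
  refine ⟨⟨fun q r => maj3 (B.run q (everyOther true (everyOther true r)))
      (B.run q (everyOther false (everyOther true r))) (B.run q (everyOther true (everyOther false r))),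
    fun n => B.coinLen n + B.coinLen n + (B.coinLen n + B.coinLen n)⟩, ?_, ?_, fun q c e he he1 => ?_⟩
  · -- the run map as a brick term
    set F : List Bool → List Bool := fun w => [B.run (d (fstF w)) (sndF w)] with hFdef
    set P : Bool → Bool → List Bool → List Bool := fun i j =>
      fanoutFn fstF (everyOther i ∘ everyOther j ∘ sndF) with hP
    have hPFP : ∀ i j, F ∘ P i j ∈ FP := fun i j =>
      comp_mem_FP hF (fanoutFn_mem_FP fstF_mem_FP
        (comp_mem_FP (everyOther_mem_FP i) (comp_mem_FP (everyOther_mem_FP j) sndF_mem_FP)))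
    have hPw : ∀ (i j : Bool) (w : List Bool), (F ∘ P i j) w =
        [B.run (d (fstF w)) (everyOther i (everyOther j (sndF w)))] := by
      intro i j w
      simp [hFdef, hP]
    have hFP : iteFn (F ∘ P true true) (iteFn (F ∘ P false true) (fun _ => [true]) (F ∘ P true false))
        (iteFn (F ∘ P false true) (F ∘ P true false) (fun _ => [false])) ∈ FP :=
      iteFn_mem_FP (hPFP true true)
        (iteFn_mem_FP (hPFP false true) (const_mem_FP [true]) (hPFP true false))
        (iteFn_mem_FP (hPFP false true) (hPFP true false) (const_mem_FP [false]))
    have heq : iteFn (F ∘ P true true) (iteFn (F ∘ P false true) (fun _ => [true]) (F ∘ P true false))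
        (iteFn (F ∘ P false true) (F ∘ P true false) (fun _ => [false])) = fun w =>
        [maj3 (B.run (d (fstF w)) (everyOther true (everyOther true (sndF w))))
          (B.run (d (fstF w)) (everyOther false (everyOther true (sndF w))))
          (B.run (d (fstF w)) (everyOther true (everyOther false (sndF w))))] := by
      funext w
      have e₁ := hPw true true w; have e₂ := hPw false true w
      have e₃ : F (P true false w) = _ := hPw true false w
      generalize B.run (d (fstF w)) (everyOther true (everyOther true (sndF w))) = a at e₁ ⊢
      generalize B.run (d (fstF w)) (everyOther false (everyOther true (sndF w))) = b at e₂ ⊢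
      generalize B.run (d (fstF w)) (everyOther true (everyOther false (sndF w))) = d₃ at e₃ ⊢
      rw [iteFn_apply e₁]
      cases a <;> cases b <;> cases d₃ <;> simp [iteFn_apply e₂, e₃, maj3]
    rw [heq] at hFP
    exact hFP
  · obtain ⟨p, hp⟩ := hp
    refine ⟨p + p + (p + p), fun n => ?_⟩
    simp only [Polynomial.eval_add]
    exact Nat.add_le_add (Nat.add_le_add (hp n) (hp n)) (Nat.add_le_add (hp n) (hp n))
  · -- the coin error of the majority
    rw [RandAlg.pr_eq_uniformProb] at he ⊢
    change uniformProb (B.coinLen (ea q).length + B.coinLen (ea q).length +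
        (B.coinLen (ea q).length + B.coinLen (ea q).length))
        {r | maj3 (B.run q (everyOther true (everyOther true r)))
          (B.run q (everyOther false (everyOther true r)))
          (B.run q (everyOther true (everyOther false r))) ∈ {b | b ≠ c}} ≤ e ^ 2 * (3 - 2 * e)
    change uniformProb (B.coinLen (ea q).length) {y | B.run q y ∈ {b | b ≠ c}} ≤ e at he
    generalize B.coinLen (ea q).length = m at he ⊢
    set Bad : Set (List Bool) := {y | B.run q y ∈ {b | b ≠ c}} with hBad
    set T : Set (List Bool) := {r | maj3 (B.run q (everyOther true (everyOther true r)))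
      (B.run q (everyOther false (everyOther true r)))
      (B.run q (everyOther true (everyOther false r))) ∈ {b | b ≠ c}} with hT
    -- the two-block events on the first deinterleaved half, and the third run on the second
    set G₂ : Set (List Bool) := {z | everyOther true z ∈ Bad ∧ everyOther false z ∈ Bad} with hG₂
    set G₁ : Set (List Bool) := {z | everyOther true z ∈ Bad ∨ everyOther false z ∈ Bad} with hG₁
    set H₀ : Set (List Bool) := {z | everyOther true z ∈ Badᶜ} with hH₀
    set H₁ : Set (List Bool) := {z | everyOther true z ∈ Bad} with hH₁
    have hsplit : T = {r | everyOther true r ∈ G₂ ∧ everyOther false r ∈ H₀} ∪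
        {r | everyOther true r ∈ G₁ ∧ everyOther false r ∈ H₁} := by
      ext r
      simp only [hT, hG₂, hG₁, hH₀, hH₁, hBad, Set.mem_setOf_eq, Set.mem_union, Set.mem_compl_iff]
      exact maj3_ne_iff _ _ _ _
    have hdisj : Disjoint {r : List Bool | everyOther true r ∈ G₂ ∧ everyOther false r ∈ H₀}
        {r | everyOther true r ∈ G₁ ∧ everyOther false r ∈ H₁} :=
      Set.disjoint_left.2 fun r h₁ h₂ => h₁.2 h₂.2
    have hab : cnt m Bad + cnt m Badᶜ = 2 ^ m := cnt_add_cnt_compl m Bad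
    have hG₂c : cnt (m + m) G₂ = cnt m Bad * cnt m Bad := cnt_everyOther m Bad Bad
    have hG₁c : cnt (m + m) G₁ + cnt m Badᶜ * cnt m Badᶜ = 2 ^ (m + m) := by
      rw [← cnt_everyOther m Badᶜ Badᶜ, ← cnt_add_cnt_compl (m + m) G₁]
      congr 1
      exact cnt_congr fun z _ => by simp [hG₁, not_or]
    have hH₀c : cnt (m + m) H₀ = cnt m Badᶜ * 2 ^ m := cnt_everyOther_true m Badᶜ
    have hH₁c : cnt (m + m) H₁ = cnt m Bad * 2 ^ m := cnt_everyOther_true m Bad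
    have hN : cnt (m + m + (m + m)) T =
        cnt m Bad * cnt m Bad * (cnt m Badᶜ * 2 ^ m) + cnt (m + m) G₁ * (cnt m Bad * 2 ^ m) := by
      rw [hsplit, cnt_union_of_disjoint _ hdisj, cnt_everyOther (m + m) G₂ H₀,
        cnt_everyOther (m + m) G₁ H₁, hG₂c, hH₀c, hH₁c]
    -- pass to the reals
    rw [uniformProb_eq_cnt_div] at he
    rw [uniformProb_eq_cnt_div, hN]
    set t : ℝ := (2 : ℝ) ^ m with ht
    have htpos : 0 < t := by positivity
    have hu0 : 0 ≤ (cnt m Bad : ℝ) / t := by positivity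
    have key := sq_mul_three_sub_mono hu0 he he1
    refine le_trans (le_of_eq ?_) key
    have hab' : (cnt m Badᶜ : ℝ) = t - cnt m Bad := by
      have := congrArg (Nat.cast (R := ℝ)) hab
      push_cast at this
      linarith
    have hG₁' : (cnt (m + m) G₁ : ℝ) = t * t - (cnt m Badᶜ : ℝ) * cnt m Badᶜ := by
      have := congrArg (Nat.cast (R := ℝ)) hG₁c
      push_cast [pow_add] at this
      linarith
    have ht4 : (2 : ℝ) ^ (m + m + (m + m)) = t * t * (t * t) := by rw [pow_add, pow_add]
    rw [ht4]
    push_cast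
    rw [hG₁', hab']
    field_simp
    ring

/-! ## §3 All rounds, and the stub -/

/-- **`k` rounds of majority of three** (generic decoder/encoder): from a Boolean randomized
algorithm with a total `FP` run map and a polynomially bounded coin budget, `k` rounds of
`exists_maj3Round_gen` give another such algorithm whose coin error is `≤ errSeq k` on every input
on which the original coin error is `≤ 1/3 = errSeq 0` (`errSeq (k+1) = (errSeq k)² (3 − 2 errSeq k)`,
`errSeq k ≤ 1`). [cite: AroraBarak2009, Thm. 7.10] -/
theorem exists_rounds_gen {α : Type} (d : List Bool → α) (ea : α → List Bool) {B : RandAlg α Bool}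
    (hF : (fun w => [B.run (d (fstF w)) (sndF w)]) ∈ FP)
    (hp : ∃ p : Polynomial ℕ, ∀ n, B.coinLen n ≤ p.eval n) (k : ℕ) :
    ∃ B' : RandAlg α Bool,
      (fun w => [B'.run (d (fstF w)) (sndF w)]) ∈ FP ∧
      (∃ p : Polynomial ℕ, ∀ n, B'.coinLen n ≤ p.eval n) ∧
      ∀ (q : α) (c : Bool), B.pr ea q {b | b ≠ c} ≤ 1 / 3 → B'.pr ea q {b | b ≠ c} ≤ errSeq k := by
  induction k with
  | zero => exact ⟨B, hF, hp, fun q c h => h.trans_eq (errSeq.eq_1).symm⟩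
  | succ k ih =>
    obtain ⟨B₁, hF₁, hp₁, herr₁⟩ := ih
    obtain ⟨B₂, hF₂, hp₂, herr₂⟩ := exists_maj3Round_gen d ea hF₁ hp₁
    refine ⟨B₂, hF₂, hp₂, fun q c h => ?_⟩
    rw [errSeq_succ]
    exact herr₂ q c (errSeq k) (herr₁ q c h) (errSeq_mem_Icc k).2

/-- **Amplification of parametrised PPT algorithms** (stub `stub_paramAmplification` of the line
`cubic-discriminant-pseudorandomness`, crux `ArithStatLadder.AvgFaceBeyondPrior`). For every PPT
randomized algorithm `A` on `paramEnc` inputs and every `η > 0` there is a PPT `A'` on the same inputs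
with `Pr_coins[A'(q) ≠ c] ≤ η` whenever `Pr_coins[A(q) ≠ c] < 1/4`: package `A` as a total `FP` run map
(`runFn_mem_FP_param`), run `k` rounds of majority of three with `errSeq k ≤ η` (`exists_rounds_gen`,
`exists_errSeq_le`; the hypothesis gives `< 1/4 ≤ 1/3 = errSeq 0`), and read the result back as a PPT
algorithm on `paramEnc` (`isPolyTime_of_runFn_mem_FP_param`). The remark "the choice of the constant
`1/4` is arbitrary" for parametrised algorithms. [cite: BogdanovTrevisan2006, §2.3 (remark after Def. 2.11)]
[cite: AroraBarak2009, Thm. 7.10] -/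
theorem stub_paramAmplification :
    ∀ A : RandAlg (List Bool × ℕ) Bool, A.IsPolyTime paramEnc encodeBool →
      ∀ η : ℝ, 0 < η → ∃ A' : RandAlg (List Bool × ℕ) Bool, A'.IsPolyTime paramEnc encodeBool ∧
        ∀ (q : List Bool × ℕ) (c : Bool),
          A.pr paramEnc q {b | b ≠ c} < 1 / 4 → A'.pr paramEnc q {b | b ≠ c} ≤ η := by
  intro A hA η hη
  obtain ⟨k, hk⟩ := exists_errSeq_le hη
  obtain ⟨B, hF, hp, herr⟩ :=
    exists_rounds_gen (fun w => (fstF w, (sndF w).length)) paramEnc (runFn_mem_FP_param hA) hA.2 k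
  refine ⟨B, isPolyTime_of_runFn_mem_FP_param hF hp, fun q c hq => (herr q c ?_).trans hk⟩
  linarith

end Summit.QuantumAdvantage.QuantumAdvantage.Theorems.AvgFaceBeyondPrior.Cubic
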